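import Summits.Ventures.LatticeQCDFlow.Exactness.Phi4HMCStickyBox
import Summits.Ventures.LatticeQCDFlow.Exactness.Phi4HMCLeapfrogStages
import HarnessLib

/-!
# The pqp integrator overshoots too: one kick–drift–kick step from the far box is rejected, no spectral gap

HONEST FRAMING: exact (Metropolis-corrected) sampling algorithms for lattice gauge theory;
figures of merit are autocorrelation/cost numbers at stated couplings and volumes; no
continuum-physics claim.  (SCALAR calibration rung S0-A: not a gauge result.)

Venture `LatticeQCDFlow` (cell pub-lqcd), topic `Exactness`; FANOUT row 2 (`s0-phi4`, HMC arm — the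
engine's SECONDARY integrator `hmcpqp`, `hmcOpPQP J λ δ N = hmcOpOf J λ (hmcProposalPQP J λ δ N)` of
`Exactness/Phi4HMCExact.lean`).  NEW WORK of the cell over `Exactness/Phi4HMCStickyBox.lean` (tail
rejection ⇒ no gap, every `Ψ`), `Phi4HMCLeapfrogStages.lean` (signed force box) and
`Phi4HMCTailEnergy.lean` / `Phi4HMCTailRejection.lean` (box bounds, thresholds).  Nothing is cited as a
fact.  For the kick–drift–kick step the mechanism is the DRIFT: the first half kick from the far box
makes every momentum `≤ −δλt³`, the full drift throws every coordinate to `≤ −δ²λt³/2`, and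
coercivity of the action (`S ≥ Σφ² − K₀`) alone makes the new energy `≳ V δ⁴λ² t⁶/4`.

## What is proved (`Λ = Fin (n+1)`, `V = n+1`, `C_J = Σ|J|`, `λ > 0`, `δ > 0`, `A_t = {t ≤ φ_x ≤ 2t ∀x}`)

* `pqp_halfKick_le_of_mem_box`, `pqp_drift_le_of_mem_box` — from `φ ∈ A_t`, `|p_y| ≤ t/δ` and
  `t/δ + 4δC_J t ≤ δλt³`, `2t ≤ δ²λt³/2`: `p_{1/2,x} ≤ −δλt³` and `q_{1,x} ≤ −δ²λt³/2` at every site;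
* **`hmcPQP_energy_gap_of_mem_box`** —
  `H(Ψ(φ,p)) − H(φ,p) ≥ V(δ²λt³/2)² − K₀ − 4C_J t² − 16λVt⁴ − V(t/δ)²/2`, `Ψ = hmcProposalPQP J λ δ 1`;
* **`hmcPQP_oneStep_accept_le_eventually`** — for every `ε > 0` there is `T ≥ 1` with acceptance
  `≤ ε` from every `φ ∈ A_t`, all `t ≥ T`;
* **`hmcPQP_oneStep_no_spectral_gap`** — hence the one-step pqp HMC for lattice φ⁴ has NO
  `L²(e^{−S})` spectral gap at any fixed step size (every `λ > 0`, `J`).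

NOT CLAIMED: `N ≥ 2` pqp steps (a pqp stage invariant would be needed); `λ = 0`.
-/

namespace Summit.Ventures.LatticeQCDFlow.Exactness

open Real MeasureTheory Filter Finset
open Summit.Ventures.LatticeQCDFlow.Scoring

section PQPNoGap

variable {n : ℕ}

/-- **The first half kick from the far box**: `φ ∈ A_t`, `|p_y| ≤ t/δ`, `t ≥ 0`, `λ ≥ 0`,
`t/δ + 4δ C_J t ≤ δλt³` ⇒ `(lfKick J λ (δ/2) φ p)_x ≤ −δλt³`. -/
theorem pqp_halfKick_le_of_mem_box {lam δ t : ℝ} (hlam : 0 ≤ lam) (hδ : 0 < δ) (ht : 0 ≤ t)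
    (J : Fin (n + 1) → Fin (n + 1) → ℝ) {φ p : Fin (n + 1) → ℝ}
    (hφ : ∀ y, t ≤ φ y ∧ φ y ≤ 2 * t) (hp : ∀ y, |p y| ≤ t / δ)
    (hbig : t / δ + 4 * δ * (∑ x, ∑ y, |J x y|) * t ≤ δ * lam * t ^ 3) (x : Fin (n + 1)) :
    lfKick J lam (δ / 2) φ p x ≤ -(δ * lam * t ^ 3) := by
  have hφ' : ∀ y, t ≤ 1 * φ y ∧ 1 * φ y ≤ 2 * t := fun y => by simpa only [one_mul] using hφ y
  have hF := (latticePhi4Force_mem_of_box hlam ht (Or.inl rfl) J φ hφ' x).1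
  rw [one_mul] at hF
  have hpx := (abs_le.mp (hp x)).2
  have h := mul_le_mul_of_nonneg_left hF (by linarith : (0 : ℝ) ≤ δ / 2)
  have e : δ / 2 * (4 * lam * t ^ 3 - 2 * (∑ x, ∑ y, |J x y|) * (2 * t))
      = 2 * (δ * lam * t ^ 3) - 2 * δ * (∑ x, ∑ y, |J x y|) * t := by ring
  rw [e] at h
  have hpos : 0 ≤ 2 * δ * (∑ x, ∑ y, |J x y|) * t := by
    have hC : 0 ≤ ∑ x, ∑ y, |J x y| := Finset.sum_nonneg fun x _ => Finset.sum_nonneg fun y _ => abs_nonneg _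
    positivity
  have e2 : 4 * δ * (∑ x, ∑ y, |J x y|) * t = 2 * (2 * δ * (∑ x, ∑ y, |J x y|) * t) := by ring
  rw [e2] at hbig
  unfold lfKick
  linarith

/-- **The drift throws every coordinate far to the other side**: additionally `2t ≤ δ²λt³/2` ⇒
`(leapfrogPQP J λ δ (φ, p)).1 x ≤ −δ²λt³/2`. -/
theorem pqp_drift_le_of_mem_box {lam δ t : ℝ} (hlam : 0 ≤ lam) (hδ : 0 < δ) (ht : 0 ≤ t)
    (J : Fin (n + 1) → Fin (n + 1) → ℝ) {φ p : Fin (n + 1) → ℝ}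
    (hφ : ∀ y, t ≤ φ y ∧ φ y ≤ 2 * t) (hp : ∀ y, |p y| ≤ t / δ)
    (hbig : t / δ + 4 * δ * (∑ x, ∑ y, |J x y|) * t ≤ δ * lam * t ^ 3)
    (hbig2 : 2 * t ≤ δ ^ 2 * lam * t ^ 3 / 2) (x : Fin (n + 1)) :
    (leapfrogPQP J lam δ (φ, p)).1 x ≤ -(δ ^ 2 * lam * t ^ 3 / 2) := by
  have hk := pqp_halfKick_le_of_mem_box hlam hδ ht J hφ hp hbig x
  have e : (leapfrogPQP J lam δ (φ, p)).1 x = φ x + δ * lfKick J lam (δ / 2) φ p x := by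
    simp only [leapfrogPQP, lfDrift]
  rw [e]
  have h1 : δ * lfKick J lam (δ / 2) φ p x ≤ δ * (-(δ * lam * t ^ 3)) :=
    mul_le_mul_of_nonneg_left hk hδ.le
  nlinarith [(hφ x).2]

/-- **THE pqp ONE-STEP PROPOSAL RAISES THE ENERGY.**  `λ > 0`, `δ > 0`, `t ≥ 0`, `φ ∈ A_t`,
`|p_y| ≤ t/δ`, the two largeness conditions: `H(Ψ(φ,p)) − H(φ,p) ≥ V(δ²λt³/2)² − K₀ − 4C_J t² − 16λVt⁴
− V(t/δ)²/2` with `Ψ = hmcProposalPQP J λ δ 1`, `K₀ = V(C_J + 1)²/(4λ)`. -/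
theorem hmcPQP_energy_gap_of_mem_box {lam δ t : ℝ} (hlam : 0 < lam) (hδ : 0 < δ) (ht : 0 ≤ t)
    (J : Fin (n + 1) → Fin (n + 1) → ℝ) {φ p : Fin (n + 1) → ℝ}
    (hφ : ∀ y, t ≤ φ y ∧ φ y ≤ 2 * t) (hp : ∀ y, |p y| ≤ t / δ)
    (hbig : t / δ + 4 * δ * (∑ x, ∑ y, |J x y|) * t ≤ δ * lam * t ^ 3)
    (hbig2 : 2 * t ≤ δ ^ 2 * lam * t ^ 3 / 2) :
    ((n : ℝ) + 1) * (δ ^ 2 * lam * t ^ 3 / 2) ^ 2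
        - ((n : ℝ) + 1) * (((∑ x, ∑ y, |J x y|) + 1) ^ 2 / (4 * lam))
        - 4 * t ^ 2 * (∑ x, ∑ y, |J x y|) - 16 * lam * ((n : ℝ) + 1) * t ^ 4
        - ((n : ℝ) + 1) * (t / δ) ^ 2 / 2
      ≤ phi4HmcEnergy J lam (hmcProposalPQP J lam δ 1 (φ, p)) - phi4HmcEnergy J lam (φ, p) := by
  have hprop : hmcProposalPQP J lam δ 1 (φ, p) = momFlip (leapfrogPQP J lam δ (φ, p)) := by
    simp only [hmcProposalPQP, Function.iterate_one]
  set z₁ := leapfrogPQP J lam δ (φ, p) with hz₁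
  rw [hprop]
  unfold phi4HmcEnergy momFlip
  simp only [Pi.neg_apply, neg_sq]
  -- (a) the new action is huge: `S(q₁) ≥ Σ q₁² − K₀ ≥ V (δ²λt³/2)² − K₀`
  have hq : ∀ x, z₁.1 x ≤ -(δ ^ 2 * lam * t ^ 3 / 2) := fun x =>
    pqp_drift_le_of_mem_box hlam.le hδ ht J hφ hp hbig hbig2 x
  have hc0 : 0 ≤ δ ^ 2 * lam * t ^ 3 / 2 := by positivity
  have hsq : ((n : ℝ) + 1) * (δ ^ 2 * lam * t ^ 3 / 2) ^ 2 ≤ ∑ x, z₁.1 x ^ 2 := by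
    have hx : ∀ x, (δ ^ 2 * lam * t ^ 3 / 2) ^ 2 ≤ z₁.1 x ^ 2 := fun x => by
      have h := hq x
      nlinarith
    calc ((n : ℝ) + 1) * (δ ^ 2 * lam * t ^ 3 / 2) ^ 2
        = ∑ _x : Fin (n + 1), (δ ^ 2 * lam * t ^ 3 / 2) ^ 2 := by
          rw [Finset.sum_const, Finset.card_univ, Fintype.card_fin, nsmul_eq_mul]; push_cast; ring
      _ ≤ ∑ x, z₁.1 x ^ 2 := Finset.sum_le_sum fun x _ => hx x
  have hS1 : ∑ x, z₁.1 x ^ 2 - ((n : ℝ) + 1) * (((∑ x, ∑ y, |J x y|) + 1) ^ 2 / (4 * lam))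
      ≤ latticePhi4Action J lam z₁.1 := by
    have h := latticePhi4Action_coercive hlam J z₁.1
    linarith
  have hkin1 : 0 ≤ ∑ x, z₁.2 x ^ 2 := Finset.sum_nonneg fun x _ => sq_nonneg _
  -- (b) the old energy is bounded on the box
  have hS0 := latticePhi4Action_le_of_mem_box hlam.le ht J hφ
  have hkin0 : ∑ x, p x ^ 2 ≤ ((n : ℝ) + 1) * (t / δ) ^ 2 := by
    have hx : ∀ x, p x ^ 2 ≤ (t / δ) ^ 2 := fun x => by
      rw [← sq_abs]; exact pow_le_pow_left₀ (abs_nonneg _) (hp x) 2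
    calc ∑ x, p x ^ 2 ≤ ∑ _x : Fin (n + 1), (t / δ) ^ 2 := Finset.sum_le_sum fun x _ => hx x
      _ = ((n : ℝ) + 1) * (t / δ) ^ 2 := by
          rw [Finset.sum_const, Finset.card_univ, Fintype.card_fin, nsmul_eq_mul]; push_cast; ring
  linarith

/-- Threshold: `t ≥ 1` and `t² ≥ (1/δ + 4δC)/(δλ)` give `t/δ + 4δ C t ≤ δλt³`. -/
theorem pqp_kick_threshold {lam δ t C : ℝ} (hlam : 0 < lam) (hδ : 0 < δ) (ht : 1 ≤ t)
    (h : (1 / δ + 4 * δ * C) / (δ * lam) ≤ t ^ 2) :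
    t / δ + 4 * δ * C * t ≤ δ * lam * t ^ 3 := by
  have ht0 : 0 < t := by linarith
  have h1 : 1 / δ + 4 * δ * C ≤ (δ * lam) * t ^ 2 := by
    have := (div_le_iff₀ (by positivity : (0 : ℝ) < δ * lam)).mp h
    linarith
  have h2 : t * (1 / δ + 4 * δ * C) ≤ t * ((δ * lam) * t ^ 2) := mul_le_mul_of_nonneg_left h1 ht0.le
  have e1 : t * (1 / δ + 4 * δ * C) = t / δ + 4 * δ * C * t := by ring
  have e2 : t * ((δ * lam) * t ^ 2) = δ * lam * t ^ 3 := by ring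
  linarith

/-- Threshold: `t ≥ 1` and `t² ≥ 4/(δ²λ)` give `2t ≤ δ²λt³/2`. -/
theorem pqp_drift_threshold {lam δ t : ℝ} (hlam : 0 < lam) (hδ : 0 < δ) (ht : 1 ≤ t)
    (h : 4 / (δ ^ 2 * lam) ≤ t ^ 2) : 2 * t ≤ δ ^ 2 * lam * t ^ 3 / 2 := by
  have ht0 : 0 < t := by linarith
  have h1 : 4 ≤ (δ ^ 2 * lam) * t ^ 2 := by
    have := (div_le_iff₀ (by positivity : (0 : ℝ) < δ ^ 2 * lam)).mp h
    linarith
  nlinarith [mul_le_mul_of_nonneg_left h1 ht0.le]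

/-- **FROM THE FAR BOX, ONE-STEP pqp HMC IS REJECTED — eventually in `t`.**  Every `λ > 0`, real `J`,
`δ > 0`: for every `ε > 0` there is `T ≥ 1` such that for every `t ≥ T` and every `φ ∈ A_t` the
one-step pqp update (`hmcProposalPQP J λ δ 1`) is accepted with probability at most `ε`. -/
theorem hmcPQP_oneStep_accept_le_eventually {lam δ : ℝ} (hlam : 0 < lam) (hδ : 0 < δ)
    (J : Fin (n + 1) → Fin (n + 1) → ℝ) {ε : ℝ} (hε : 0 < ε) :
    ∃ T : ℝ, 1 ≤ T ∧ ∀ t : ℝ, T ≤ t → ∀ φ : Fin (n + 1) → ℝ, (∀ y, t ≤ φ y ∧ φ y ≤ 2 * t) →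
      (∫ p, involAccept (phi4HmcEnergy J lam) (hmcProposalPQP J lam δ 1) (φ, p) * momentumWeight p)
          / momentumZ n ≤ ε := by
  have hC0 : 0 ≤ ∑ x, ∑ y, |J x y| :=
    Finset.sum_nonneg fun x _ => Finset.sum_nonneg fun y _ => abs_nonneg _
  have hV0 : (0 : ℝ) < (n : ℝ) + 1 := by positivity
  have hL0 : 0 ≤ max 0 (Real.log (2 / ε)) := le_max_left _ _
  -- thresholds on `t²`
  obtain ⟨C1, hC1, hC10⟩ : ∃ C1 : ℝ, C1 = (16 * lam * ((n : ℝ) + 1)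
      + (4 * (∑ x, ∑ y, |J x y|) + ((n : ℝ) + 1) * (1 / δ) ^ 2 / 2)
      + ((n : ℝ) + 1) * (((∑ x, ∑ y, |J x y|) + 1) ^ 2 / (4 * lam)) + max 0 (Real.log (2 / ε)))
        / (((n : ℝ) + 1) * (δ ^ 2 * lam / 2) ^ 2) ∧ 0 ≤ C1 := ⟨_, rfl, by positivity⟩
  obtain ⟨C2, hC2, hC20⟩ : ∃ C2 : ℝ,
      C2 = (1 / δ + 4 * δ * (∑ x, ∑ y, |J x y|)) / (δ * lam) ∧ 0 ≤ C2 := ⟨_, rfl, by positivity⟩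
  obtain ⟨C3, hC3, hC30⟩ : ∃ C3 : ℝ, C3 = 4 / (δ ^ 2 * lam) ∧ 0 ≤ C3 := ⟨_, rfl, by positivity⟩
  obtain ⟨C4, hC4, hC40⟩ : ∃ C4 : ℝ, C4 = 2 * ((n : ℝ) + 1) * δ ^ 2 / ε ∧ 0 ≤ C4 :=
    ⟨_, rfl, by positivity⟩
  refine ⟨1 + C1 + C2 + C3 + C4, by linarith, fun t ht φ hφ => ?_⟩
  have ht1 : 1 ≤ t := by linarith
  have ht0 : 0 < t := by linarith
  have htsq : t ≤ t ^ 2 := by nlinarith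
  have hbig := pqp_kick_threshold (C := ∑ x, ∑ y, |J x y|) hlam hδ ht1 (by rw [← hC2]; linarith)
  have hbig2 := pqp_drift_threshold hlam hδ ht1 (by rw [← hC3]; linarith)
  -- the energy gap `≥ L` via `poly_gap_ge`
  have hgapL : ∀ p : Fin (n + 1) → ℝ, (∀ y, |p y| ≤ t / δ) →
      max 0 (Real.log (2 / ε)) ≤ phi4HmcEnergy J lam (hmcProposalPQP J lam δ 1 (φ, p))
        - phi4HmcEnergy J lam (φ, p) := by
    intro p hp
    have hgap := hmcPQP_energy_gap_of_mem_box hlam hδ ht0.le J hφ hp hbig hbig2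
    have hthr : 16 * lam * ((n : ℝ) + 1) + (4 * (∑ x, ∑ y, |J x y|) + ((n : ℝ) + 1) * (1 / δ) ^ 2 / 2)
        + ((n : ℝ) + 1) * (((∑ x, ∑ y, |J x y|) + 1) ^ 2 / (4 * lam)) + max 0 (Real.log (2 / ε))
        ≤ ((n : ℝ) + 1) * (δ ^ 2 * lam / 2) ^ 2 * t ^ 2 := by
      have h1 : C1 ≤ t ^ 2 := by linarith
      have := (div_le_iff₀ (by positivity : (0 : ℝ) < ((n : ℝ) + 1) * (δ ^ 2 * lam / 2) ^ 2)).mp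
        (hC1 ▸ h1)
      linarith
    have hpoly := poly_gap_ge (by positivity) (by positivity) hL0 ht1 hthr
    have e : ((n : ℝ) + 1) * (δ ^ 2 * lam / 2) ^ 2 * t ^ 6 - 16 * lam * ((n : ℝ) + 1) * t ^ 4
        - (4 * (∑ x, ∑ y, |J x y|) + ((n : ℝ) + 1) * (1 / δ) ^ 2 / 2) * t ^ 2
        - ((n : ℝ) + 1) * (((∑ x, ∑ y, |J x y|) + 1) ^ 2 / (4 * lam))
        = ((n : ℝ) + 1) * (δ ^ 2 * lam * t ^ 3 / 2) ^ 2
          - ((n : ℝ) + 1) * (((∑ x, ∑ y, |J x y|) + 1) ^ 2 / (4 * lam))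
          - 4 * t ^ 2 * (∑ x, ∑ y, |J x y|) - 16 * lam * ((n : ℝ) + 1) * t ^ 4
          - ((n : ℝ) + 1) * (t / δ) ^ 2 / 2 := by ring
    linarith
  have hacc := accept_le_of_gap' hδ ht0 J (hmcProposalPQP J lam δ 1) hgapL
  have hcheb := cheb_threshold (δ := δ) (V := (n : ℝ) + 1) ht0 hε (by rw [← hC4]; linarith)
  have hexp := exp_neg_threshold hε
  linarith

/-- **ONE-STEP pqp HMC FOR LATTICE φ⁴ HAS NO SPECTRAL GAP** (every `λ > 0`, real `J`, `δ > 0`;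
`K = hmcOpPQP J λ δ 1`): for every `ε > 0` there is `t ≥ 1` such that `g = χ_t − ⟨χ_t⟩` satisfies
`∫ g² e^{−S} > 0` and `ρ_g(1) ≥ 1 − ε`. -/
theorem hmcPQP_oneStep_no_spectral_gap {lam δ : ℝ} (hlam : 0 < lam) (hδ : 0 < δ)
    (J : Fin (n + 1) → Fin (n + 1) → ℝ) {ε : ℝ} (hε : 0 < ε) :
    ∃ t : ℝ, 1 ≤ t ∧
      0 < ∫ φ, ((if (∀ x, t ≤ φ x ∧ φ x ≤ 2 * t) then (1 : ℝ) else 0)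
          - gibbsExpect J lam (fun ψ => if (∀ x, t ≤ ψ x ∧ ψ x ≤ 2 * t) then (1 : ℝ) else 0)) ^ 2
          * gibbsWeight J lam φ ∧
      1 - ε ≤ (∫ φ, ((if (∀ x, t ≤ φ x ∧ φ x ≤ 2 * t) then (1 : ℝ) else 0)
          - gibbsExpect J lam (fun ψ => if (∀ x, t ≤ ψ x ∧ ψ x ≤ 2 * t) then (1 : ℝ) else 0))
        * hmcOpPQP J lam δ 1 (fun ψ => (if (∀ x, t ≤ ψ x ∧ ψ x ≤ 2 * t) then (1 : ℝ) else 0)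
          - gibbsExpect J lam (fun ψ => if (∀ x, t ≤ ψ x ∧ ψ x ≤ 2 * t) then (1 : ℝ) else 0)) φ
        * gibbsWeight J lam φ)
        / ∫ φ, ((if (∀ x, t ≤ φ x ∧ φ x ≤ 2 * t) then (1 : ℝ) else 0)
          - gibbsExpect J lam (fun ψ => if (∀ x, t ≤ ψ x ∧ ψ x ≤ 2 * t) then (1 : ℝ) else 0)) ^ 2
          * gibbsWeight J lam φ := by
  have hK : hmcOpPQP J lam δ 1 = hmcOpOf J lam (hmcProposalPQP J lam δ 1) := rfl
  rw [hK]
  exact hmcOpOf_no_spectral_gap_of_box_rejection hlam J (measurable_hmcProposalPQP J lam δ 1)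
    (hmcProposalPQP_involutive J lam δ 1) (measurePreserving_hmcProposalPQP J lam δ 1)
    (fun ε' hε' => hmcPQP_oneStep_accept_le_eventually hlam hδ J hε') hε

end PQPNoGap

end Summit.Ventures.LatticeQCDFlow.Exactness
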